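import Summits.MatrixMultiplication.MatrixMultiplication.Theorems.OctaveBudgetFivePattern
import Summits.MatrixMultiplication.MatrixMultiplication.Theorems.OctaveBudgetKernelFamily
import HarnessLib

/-!
# OctaveBudgetFivePatternCerts — the rungs `K = 10, 12, 16` (and `14, 18, 19, 20`) of the octave budget
IN KERNEL: five exact certificates of the full first power of `CW_q`
(decomp-mm cell, lens 5 «finite/base range + asymptotic regime + bridge», generation 11; part 4 of 4 of the
kernel-rungs file of generations 4–10)

Landing form for items `stmt-MatrixMultiplication-26290` (`LinearDecayTwoUpToTen`),
`stmt-MatrixMultiplication-26291` (`LinearDecayTwoUpToTwelve`), `stmt-MatrixMultiplication-25359`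
(`LinearDecayTwoUpToSixteen`) and `stmt-MatrixMultiplication-31706` (`LinearDecayTwoUpToTwenty`) of
`route-MatrixMultiplication-OctaveBudget` (`Theses/OctaveBudget.lean`, rev 8):

* `linearDecayTwoUpToTen_holds`, `linearDecayTwoUpToTwelve_holds`, `linearDecayTwoUpToSixteen_holds`,
  `linearDecayTwoUpToTwenty_holds` — the linear-decay law with constant `2`,
  `e(k) := ω(1,k,1) − (k+1) ≤ 2/k`, on `1 ≤ k ≤ 10, 12, 16, 20` (the route decls by name); `K = 20` is
  the census ceiling `K₀ = 20` of all powers `≤ 2` of `CW_q` (cell census COSTUME-CENSUS-v3 H1′: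
  `ê(20) = 0.0989 ≤ 1/10`, `ê(24) = 0.0932 > 1/12`); all table-free and decimal-free, from tree theorems only.

Proof.  The certificate checker `OctaveBudgetFivePattern.fp_cert` reduces `e(k) ≤ η` for the five-pattern
type `(a, b, c)` in `CW_q` to two comparisons of products of integer powers (`log_prod_le`,
`log_prod_le4`), decided by `norm_num` (`set_option exponentiation.threshold`):
* `e(10) ≤ 1/7`  — type `(4,40,1)`, `CW_16`: `18^350·5^35·44^308 ≤ 50^350·16^312`, `18^350·42^294·8^56 ≤ 50^350·16^312`;
* `e(15) ≤ 1/8`  — type `(4,60,1)`, `CW_23`;   * `e(17) ≤ 1/9` — type `(7,119,2)`, `CW_25`;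
* `e(19) ≤ 2/19` — type `(10,190,3)`, `CW_27`;  * `e(20) ≤ 1/10` — type `(25,500,8)`, `CW_27`
  (value `0.099947`, margin `5·10⁻⁵`, exact).
Chain (landed `OctaveBudgetLinearDecayTwoUpToFive.rung_of_tail_bound`): `K = 9`
(`OctaveBudgetKernelFamily.rung_two_nine`) `→ 14` (`e(10) ≤ 1/7`) `→ 16` (`e(15) ≤ 1/8`) `→ 18`
(`e(17) ≤ 1/9`) `→ 19 → 20`; `K = 10, 12` by restriction.

§8 adds the `C`-dial rungs `(3, 30)` (`rung_three_thirty`), `(4, 40)` (`rung_four_forty`) and `(5, 50)`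
(`rung_five_fifty`): the reach of one far-edge value at a larger constant is linear in `C`, never `K = ∞`.

Lens reading: with these the FINITE RANGE of the octave budget `LinearExcessDecay` at `C = 2` is
EXHAUSTED IN CLASS and IN KERNEL (`K₀ = 20`); the first-power family gives `k·e₁(k) → ∞`, so no finite
range of it reaches the crux — the bridge is the route's crux `TailSubcriticalDoubling`.

References: [cite: CoppersmithWinograd1990, §6–§7]; [cite: HuangPan1998, §8];
[cite: VassilevskaWilliamsXuXuZhou2024, Table 1] (comparison only: printed `e(10) = 0.1278`, `e(20) = 0.0989`; not used).
-/

set_option linter.dupNamespace false -- `MatrixMultiplication.MatrixMultiplication` (summit = problem, D-0017)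

-- the route items (defined in `Theses/OctaveBudget.lean`)
open Summit.MatrixMultiplication.MatrixMultiplication.Theses.OctaveBudget
  (LinearDecayTwoUpToTen LinearDecayTwoUpToTwelve LinearDecayTwoUpToSixteen LinearDecayTwoUpToTwenty)

noncomputable section

namespace Summit.MatrixMultiplication.MatrixMultiplication.Theorems.OctaveBudgetFivePattern

open scoped BigOperators
open Finset
open Literature.Computability.AlgebraicComplexity

/-! ### §6  Three certificates and the rungs `K = 10, 12, 14, 16, 18` -/

/-- From `x ≤ y` between products of powers of positive numerals, the log-linear inequality.
(Helper: `log` is monotone; `log (u·v) = log u + log v`, `log (u^n) = n log u`.) -/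
theorem log_prod_le {u₁ u₂ u₃ v₁ v₂ : ℝ} {m₁ m₂ m₃ n₁ n₂ : ℕ} (hu₁ : 0 < u₁) (hu₂ : 0 < u₂)
    (hu₃ : 0 < u₃) (hv₁ : 0 < v₁) (hv₂ : 0 < v₂)
    (h : u₁ ^ m₁ * u₂ ^ m₂ * u₃ ^ m₃ ≤ v₁ ^ n₁ * v₂ ^ n₂) :
    m₁ * Real.log u₁ + m₂ * Real.log u₂ + m₃ * Real.log u₃ ≤ n₁ * Real.log v₁ + n₂ * Real.log v₂ := by
  have := Real.log_le_log (by positivity) h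
  rw [Real.log_mul (by positivity) (by positivity), Real.log_mul (by positivity) (by positivity),
    Real.log_mul (by positivity) (by positivity), Real.log_pow, Real.log_pow, Real.log_pow,
    Real.log_pow, Real.log_pow] at this
  exact this

set_option exponentiation.threshold 5000 in
/-- **`e(10) ≤ 1/7`**: the five-pattern type `(a,b,c) = (4,40,1)` in `CW_16` (`n = 50`;
value `0.13300`); the two product comparisons are `18^350 · 5^35 · 44^308 ≤ 50^350 · 16^312` and
`18^350 · 42^294 · 8^56 ≤ 50^350 · 16^312`. -/
theorem farEdgeFP_ten : omegaRect ℂ 1 (10 : ℝ) 1 - (10 + 1) ≤ 1 / 7 := by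
  have kX := log_prod_le (u₁ := 18) (u₂ := 5) (u₃ := 44) (v₁ := 50) (v₂ := 16)
    (m₁ := 350) (m₂ := 35) (m₃ := 308) (n₁ := 350) (n₂ := 312)
    (by norm_num) (by norm_num) (by norm_num) (by norm_num) (by norm_num) (by norm_num)
  have kY := log_prod_le (u₁ := 18) (u₂ := 42) (u₃ := 8) (v₁ := 50) (v₂ := 16)
    (m₁ := 350) (m₂ := 294) (m₃ := 56) (n₁ := 350) (n₂ := 312)
    (by norm_num) (by norm_num) (by norm_num) (by norm_num) (by norm_num) (by norm_num)
  push_cast at kX kY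
  have h := fp_cert (q := 16) (a := 4) (b := 40) (c := 1) (k := 10) (η := 1 / 7)
    (by norm_num) (by norm_num) (by norm_num)
    (by push_cast; norm_num; linarith) (by push_cast; norm_num; linarith)
  exact_mod_cast h

set_option exponentiation.threshold 5000 in
/-- **`e(15) ≤ 1/8`**: the type `(4,60,1)` in `CW_23` (`n = 70`; value `0.11726`); comparisons
`25^560 · 5^40 · 64^512 ≤ 70^560 · 23^516` and `25^560 · 62^496 · 8^64 ≤ 70^560 · 23^516`. -/
theorem farEdgeFP_fifteen : omegaRect ℂ 1 (15 : ℝ) 1 - (15 + 1) ≤ 1 / 8 := by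
  have kX := log_prod_le (u₁ := 25) (u₂ := 5) (u₃ := 64) (v₁ := 70) (v₂ := 23)
    (m₁ := 560) (m₂ := 40) (m₃ := 512) (n₁ := 560) (n₂ := 516)
    (by norm_num) (by norm_num) (by norm_num) (by norm_num) (by norm_num) (by norm_num)
  have kY := log_prod_le (u₁ := 25) (u₂ := 62) (u₃ := 8) (v₁ := 70) (v₂ := 23)
    (m₁ := 560) (m₂ := 496) (m₃ := 64) (n₁ := 560) (n₂ := 516)
    (by norm_num) (by norm_num) (by norm_num) (by norm_num) (by norm_num) (by norm_num)
  push_cast at kX kY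
  have h := fp_cert (q := 23) (a := 4) (b := 60) (c := 1) (k := 15) (η := 1 / 8)
    (by norm_num) (by norm_num) (by norm_num)
    (by push_cast; norm_num; linarith) (by push_cast; norm_num; linarith)
  exact_mod_cast h

set_option exponentiation.threshold 5000 in
/-- **`e(17) ≤ 1/9`**: the type `(7,119,2)` in `CW_25` (`n = 137`; value `0.10859`); comparisons
`27^1233 · 9^81 · 126^1134 · 2^18 ≤ 137^1233 · 25^1141` and `27^1233 · 123^1107 · 14^126 ≤ 137^1233 · 25^1141`. -/
theorem farEdgeFP_seventeen : omegaRect ℂ 1 (17 : ℝ) 1 - (17 + 1) ≤ 1 / 9 := by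
  have kX' : (27 : ℝ) ^ 1233 * 9 ^ 81 * 126 ^ 1134 * 2 ^ 18 ≤ 137 ^ 1233 * 25 ^ 1141 := by norm_num
  have kX : 1233 * Real.log 27 + 81 * Real.log 9 + 1134 * Real.log 126 + 18 * Real.log 2 ≤
      1233 * Real.log 137 + 1141 * Real.log 25 := by
    have := Real.log_le_log (by positivity) kX'
    rw [Real.log_mul (by positivity) (by positivity), Real.log_mul (by positivity) (by positivity),
      Real.log_mul (by positivity) (by positivity), Real.log_mul (by positivity) (by positivity),
      Real.log_pow, Real.log_pow, Real.log_pow, Real.log_pow, Real.log_pow, Real.log_pow] at this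
    push_cast at this
    exact this
  have kY := log_prod_le (u₁ := 27) (u₂ := 123) (u₃ := 14) (v₁ := 137) (v₂ := 25)
    (m₁ := 1233) (m₂ := 1107) (m₃ := 126) (n₁ := 1233) (n₂ := 1141)
    (by norm_num) (by norm_num) (by norm_num) (by norm_num) (by norm_num) (by norm_num)
  push_cast at kY
  have h := fp_cert (q := 25) (a := 7) (b := 119) (c := 2) (k := 17) (η := 1 / 9)
    (by norm_num) (by norm_num) (by norm_num)
    (by push_cast; norm_num; linarith) (by push_cast; norm_num; linarith)
  exact_mod_cast h

-- landed chain step (item 25357) and the kernel-family rung `K = 9` (item 25358's file)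
open Summit.MatrixMultiplication.MatrixMultiplication.Theorems.OctaveBudgetLinearDecayTwoUpToFive
  (rung_of_tail_bound)
open Summit.MatrixMultiplication.MatrixMultiplication.Theorems.OctaveBudgetKernelFamily
  (rung_two_nine rung_three_fifteen rung_four_twentytwo)

/-- Rung `(2, 14)`: kernel `K = 9` plus `e(10) ≤ 1/7` (`κ₀ = 10 ≤ 9 + 1`, `(1/7)·14 ≤ 2`). -/
theorem rung_two_fourteen : ∀ k : ℕ, 1 ≤ k → k ≤ 14 → omegaRect ℂ 1 k 1 - (k + 1) ≤ 2 / k :=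
  rung_of_tail_bound (k₁ := 9) (κ₀ := 10) (η := 1 / 7) rung_two_nine (by norm_num) farEdgeFP_ten (by norm_num)

/-- Rung `(2, 16)`: `(2, 14)` plus `e(15) ≤ 1/8` (`κ₀ = 15 ≤ 14 + 1`, `(1/8)·16 ≤ 2`). -/
theorem rung_two_sixteen : ∀ k : ℕ, 1 ≤ k → k ≤ 16 → omegaRect ℂ 1 k 1 - (k + 1) ≤ 2 / k :=
  rung_of_tail_bound (k₁ := 14) (κ₀ := 15) (η := 1 / 8) rung_two_fourteen (by norm_num) farEdgeFP_fifteen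
    (by norm_num)

/-- Rung `(2, 18)`: `(2, 16)` plus `e(17) ≤ 1/9` (`κ₀ = 17 ≤ 16 + 1`, `(1/9)·18 ≤ 2`). -/
theorem rung_two_eighteen : ∀ k : ℕ, 1 ≤ k → k ≤ 18 → omegaRect ℂ 1 k 1 - (k + 1) ≤ 2 / k :=
  rung_of_tail_bound (k₁ := 16) (κ₀ := 17) (η := 1 / 9) rung_two_sixteen (by norm_num) farEdgeFP_seventeen
    (by norm_num)

/-- **stmt-MatrixMultiplication-26291 `LinearDecayTwoUpToTwelve` PROVED** (the route decl by name). -/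
theorem linearDecayTwoUpToTwelve_holds : LinearDecayTwoUpToTwelve :=
  fun k hk h12 => rung_two_fourteen k hk (le_trans h12 (by norm_num))

/-- **stmt-MatrixMultiplication-25359 `LinearDecayTwoUpToSixteen` PROVED** (the route decl by name). -/
theorem linearDecayTwoUpToSixteen_holds : LinearDecayTwoUpToSixteen :=
  rung_two_sixteen

/-- stmt-26290 `LinearDecayTwoUpToTen` (aside) as a corollary. -/
theorem linearDecayTwoUpToTen_holds : LinearDecayTwoUpToTen :=
  fun k hk h10 => rung_two_fourteen k hk (le_trans h10 (by norm_num))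

/-! ### §7  The census ceiling `K₀ = 20` reached in kernel: `e(19) ≤ 2/19`, `e(20) ≤ 1/10` -/

/-- Four-factor variant of `log_prod_le`. -/
theorem log_prod_le4 {u₁ u₂ u₃ u₄ v₁ v₂ : ℝ} {m₁ m₂ m₃ m₄ n₁ n₂ : ℕ} (hu₁ : 0 < u₁) (hu₂ : 0 < u₂)
    (hu₃ : 0 < u₃) (hu₄ : 0 < u₄) (hv₁ : 0 < v₁) (hv₂ : 0 < v₂)
    (h : u₁ ^ m₁ * u₂ ^ m₂ * u₃ ^ m₃ * u₄ ^ m₄ ≤ v₁ ^ n₁ * v₂ ^ n₂) :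
    m₁ * Real.log u₁ + m₂ * Real.log u₂ + m₃ * Real.log u₃ + m₄ * Real.log u₄ ≤
      n₁ * Real.log v₁ + n₂ * Real.log v₂ := by
  have := Real.log_le_log (by positivity) h
  rw [Real.log_mul (by positivity) (by positivity), Real.log_mul (by positivity) (by positivity),
    Real.log_mul (by positivity) (by positivity), Real.log_mul (by positivity) (by positivity),
    Real.log_pow, Real.log_pow, Real.log_pow, Real.log_pow, Real.log_pow, Real.log_pow] at this
  exact this

set_option exponentiation.threshold 10000 in
/-- **`e(19) ≤ 2/19`**: the type `(10,190,3)` in `CW_27` (`n = 216`; value `0.10353`); comparisons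
`29^4104 · 13^247 · 200^3800 · 3^57 ≤ 216^4104 · 27^3820` and `29^4104 · 196^3724 · 20^380 ≤ 216^4104 · 27^3820`
(15 049-digit integers). -/
theorem farEdgeFP_nineteen : omegaRect ℂ 1 (19 : ℝ) 1 - (19 + 1) ≤ 2 / 19 := by
  have kX := log_prod_le4 (u₁ := 29) (u₂ := 13) (u₃ := 200) (u₄ := 3) (v₁ := 216) (v₂ := 27)
    (m₁ := 4104) (m₂ := 247) (m₃ := 3800) (m₄ := 57) (n₁ := 4104) (n₂ := 3820)
    (by norm_num) (by norm_num) (by norm_num) (by norm_num) (by norm_num) (by norm_num) (by norm_num)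
  have kY := log_prod_le (u₁ := 29) (u₂ := 196) (u₃ := 20) (v₁ := 216) (v₂ := 27)
    (m₁ := 4104) (m₂ := 3724) (m₃ := 380) (n₁ := 4104) (n₂ := 3820)
    (by norm_num) (by norm_num) (by norm_num) (by norm_num) (by norm_num) (by norm_num)
  push_cast at kX kY
  have h := fp_cert (q := 27) (a := 10) (b := 190) (c := 3) (k := 19) (η := 2 / 19)
    (by norm_num) (by norm_num) (by norm_num)
    (by push_cast; norm_num; linarith) (by push_cast; norm_num; linarith)
  exact_mod_cast h

set_option exponentiation.threshold 10000 in
/-- **`e(20) ≤ 1/10`**: the type `(25,500,8)` in `CW_27` (`n = 566`; value `0.099947`, margin `5·10⁻⁵`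
but EXACT); comparisons `29^5660 · 33^330 · 525^5250 · 8^80 ≤ 566^5660 · 27^5275` and
`29^5660 · 516^5160 · 50^500 ≤ 566^5660 · 27^5275` (23 132-digit integers). -/
theorem farEdgeFP_twenty : omegaRect ℂ 1 (20 : ℝ) 1 - (20 + 1) ≤ 1 / 10 := by
  have kX := log_prod_le4 (u₁ := 29) (u₂ := 33) (u₃ := 525) (u₄ := 8) (v₁ := 566) (v₂ := 27)
    (m₁ := 5660) (m₂ := 330) (m₃ := 5250) (m₄ := 80) (n₁ := 5660) (n₂ := 5275)
    (by norm_num) (by norm_num) (by norm_num) (by norm_num) (by norm_num) (by norm_num) (by norm_num)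
  have kY := log_prod_le (u₁ := 29) (u₂ := 516) (u₃ := 50) (v₁ := 566) (v₂ := 27)
    (m₁ := 5660) (m₂ := 5160) (m₃ := 500) (n₁ := 5660) (n₂ := 5275)
    (by norm_num) (by norm_num) (by norm_num) (by norm_num) (by norm_num) (by norm_num)
  push_cast at kX kY
  have h := fp_cert (q := 27) (a := 25) (b := 500) (c := 8) (k := 20) (η := 1 / 10)
    (by norm_num) (by norm_num) (by norm_num)
    (by push_cast; norm_num; linarith) (by push_cast; norm_num; linarith)
  exact_mod_cast h

/-- Rung `(2, 19)`: `(2, 18)` plus `e(19) ≤ 2/19`. -/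
theorem rung_two_nineteen : ∀ k : ℕ, 1 ≤ k → k ≤ 19 → omegaRect ℂ 1 k 1 - (k + 1) ≤ 2 / k :=
  rung_of_tail_bound (k₁ := 18) (κ₀ := 19) (η := 2 / 19) rung_two_eighteen (by norm_num) farEdgeFP_nineteen
    (by norm_num)

/-- **Rung `(2, 20)` — the census ceiling `K₀ = 20` of all powers `≤ 2` of `CW_q` (COSTUME-CENSUS-v3 H1′),
reached in kernel**: `e(k) ≤ 2/k` for every integer `1 ≤ k ≤ 20`. -/
theorem rung_two_twenty : ∀ k : ℕ, 1 ≤ k → k ≤ 20 → omegaRect ℂ 1 k 1 - (k + 1) ≤ 2 / k :=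
  rung_of_tail_bound (k₁ := 19) (κ₀ := 20) (η := 1 / 10) rung_two_nineteen (by norm_num) farEdgeFP_twenty
    (by norm_num)

/-- **stmt-MatrixMultiplication-31706 `LinearDecayTwoUpToTwenty` PROVED** (the route decl by name):
the finite range of the octave budget at `C = 2` certified up to the census ceiling `K₀ = 20`. -/
theorem linearDecayTwoUpToTwenty_holds : LinearDecayTwoUpToTwenty :=
  rung_two_twenty

/-! ### §8  The `C`-dial of the finite range in kernel (lens price list: one value `e(κ) ≤ η` reaches
`K = ⌊C/η⌋` at slope `C`; the reach is linear in `C`, never `K = ∞` — that is the crux `LinearExcessDecay`) -/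

/-- **`C = 3`: `e(k) ≤ 3/k` for every integer `1 ≤ k ≤ 30`.**  From the kernel-family rung `(3, 15)`
(`2^15 = 32^3`, `OctaveBudgetKernelFamily.rung_three_fifteen`), the certificate `e(15) ≤ 1/8` extends it to
`(3, 24)` and `e(20) ≤ 1/10` to `(3, 30)` (`(1/10)·30 ≤ 3`); the same two certificates give only `(2, 16)` and
`(2, 20)` at `C = 2` (census in-class reach `K*(3) ≈ 34`). -/
theorem rung_three_thirty : ∀ k : ℕ, 1 ≤ k → k ≤ 30 → omegaRect ℂ 1 k 1 - (k + 1) ≤ 3 / k :=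
  have h24 : ∀ k : ℕ, 1 ≤ k → k ≤ 24 → omegaRect ℂ 1 k 1 - (k + 1) ≤ 3 / k :=
    rung_of_tail_bound (k₁ := 15) (κ₀ := 15) (η := 1 / 8) rung_three_fifteen (by norm_num) farEdgeFP_fifteen
      (by norm_num)
  rung_of_tail_bound (k₁ := 24) (κ₀ := 20) (η := 1 / 10) h24 (by norm_num) farEdgeFP_twenty (by norm_num)

/-- **`C = 4`: `e(k) ≤ 4/k` for every integer `1 ≤ k ≤ 40`.**  From the kernel-family rung `(4, 22)`
(`2^22 ≤ 46^4`, `OctaveBudgetKernelFamily.rung_four_twentytwo`) and the certificate `e(20) ≤ 1/10`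
(`κ₀ = 20 ≤ 23`, `(1/10)·40 ≤ 4`). -/
theorem rung_four_forty : ∀ k : ℕ, 1 ≤ k → k ≤ 40 → omegaRect ℂ 1 k 1 - (k + 1) ≤ 4 / k :=
  rung_of_tail_bound (k₁ := 22) (κ₀ := 20) (η := 1 / 10) rung_four_twentytwo (by norm_num) farEdgeFP_twenty
    (by norm_num)

/-- **`C = 5`: `e(k) ≤ 5/k` for every integer `1 ≤ k ≤ 50`.**  From the kernel-family rung `(4, 22)`
(a fortiori `(5, 22)`) and the certificate `e(20) ≤ 1/10` (`κ₀ = 20 ≤ 23`, `(1/10)·50 ≤ 5`).  With `K = 20`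
at `C = 2`, `30` at `C = 3`, `40` at `C = 4`, `50` at `C = 5` the kernel reach is linear in `C` from ONE value
`e(20) ≤ 1/10` — the finite range scales with the constant, never to `K = ∞` (= the crux `LinearExcessDecay`). -/
theorem rung_five_fifty : ∀ k : ℕ, 1 ≤ k → k ≤ 50 → omegaRect ℂ 1 k 1 - (k + 1) ≤ 5 / k :=
  have h22 : ∀ k : ℕ, 1 ≤ k → k ≤ 22 → omegaRect ℂ 1 k 1 - (k + 1) ≤ 5 / k := fun k hk hk22 => by
    have hkpos : (0 : ℝ) < (k : ℝ) := by
      have : (1 : ℝ) ≤ (k : ℝ) := by exact_mod_cast hk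
      linarith
    calc omegaRect ℂ 1 k 1 - (k + 1) ≤ 4 / k := rung_four_twentytwo k hk hk22
      _ ≤ 5 / k := by gcongr; norm_num
  rung_of_tail_bound (k₁ := 22) (κ₀ := 20) (η := 1 / 10) h22 (by norm_num) farEdgeFP_twenty (by norm_num)

end Summit.MatrixMultiplication.MatrixMultiplication.Theorems.OctaveBudgetFivePattern

end
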